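import Summits.BirchSwinnertonDyer.BirchSwinnertonDyer.Theorems.BiquadraticEisensteinDescentHeegnerTwistCouplingInSupplySylvesterTwistPhiLocalInert
import Summits.BirchSwinnertonDyer.BirchSwinnertonDyer.Theorems.BiquadraticEisensteinDescentHeegnerTwistCouplingInSupplySylvesterTwistCubeUnits
import Literature.NumberTheory.QuadraticFields.UnitsModCubes
import Literature.NumberTheory.QuadraticFields.RealQuadraticClassNumberOneSmall
import Literature.NumberTheory.QuadraticFields.DiscriminantOfSqrt
import Literature.NumberTheory.Automorphic.AdicCompletionCompact
import HarnessLib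

set_option linter.dupNamespace false -- `Summit.BirchSwinnertonDyer.BirchSwinnertonDyer.Theorems.…` (summit = sub, D-0017)
set_option autoImplicit false

/-!
# Crux `HeegnerTwistCouplingInSupply` (stmt-BirchSwinnertonDyer-21381) — programme «TWISTED 3-ISOGENY DESCENT», file P5c:
# the SHARP `φ`-BOX over the REAL Kummer field `F = ℚ(√6)` for the Sylvester twist `y² = x³ − 2p²` under the certificate (h1)
# «some unit of `𝓞_F` is not a cube modulo `p`»

Route `BiquadraticEisensteinDescent` (cell `pub/bsd-wall`, width seat `bsd-wall-cm-bed-w4` g33; `--supports` 21381, helper). Assembly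
of files P5a (all valuations of a norm-cube Ш-parameter are divisible by `3`), P5b (at the inert `p` such a parameter is a local cube)
and P6c₁ (class number one ⟹ unit × cube) with three arithmetic inputs of `F = ℚ(√6)` proved here:

* §1 `discr_eq_twentyFour` (`d_F = 24`), `natCast_not_mem_span_natCast` (`n ∉ (p)` for `p ∤ n`, by norms), ★
  `span_natCast_isMaximal_of_not_isSquare_six` — for `ω² = 6` and a prime `p` with `(6/p) = −1` the ideal `(p)` of `𝓞 F` is
  MAXIMAL (`𝓞 F = ℤ ⊕ ℤτ`, `τ² = 6` by Bhargava's normal form with `d_F = 24`; `(u + vτ)(u − vτ) = u² − 6v²` is prime to `p`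
  unless `u + vτ ∈ (p)`, and then Bézout inverts `u + vτ` modulo `p`);
* §2 ★ `exists_sub_pow_three_mem_of_eq_cube` — residue approximation (any number field): an algebraic integer which is a cube in
  `F_v` is a cube modulo `v` (density of `𝓞 F` in `𝒪_v`, tree `exists_ringOfIntegers_valued_sub_lt_one`);
* §3 ★ `exists_eq_pow_three_of_sub_cube_mem` — REAL quadratic units modulo cubes: `U/U³ ≅ ℤ/3` (tree `UnitsModCubes`: `expMod3`,
  `ker_expMod3`); hence if ONE unit is a non-cube modulo an ideal `I`, every unit which is a cube modulo `I` is the cube of a unit;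
* §4 ★★ `torsorClass_eq_zero_of_mem_sha_of_norm_cube_phi` — THE SHARP `φ`-BOX: for `[F:ℚ] = 2`, `ω² = 6`, any `c ∈ Aut(F/ℚ)`,
  a prime `p ≡ 8 (mod 9)`, `p = a² + 2b²`, the certificate (h1) `∃ u₀ ∈ 𝓞_Fˣ, ∀ x, u₀ − x³ ∉ (p)`, and the Mordell datum
  `E_F = mordellCurve(−3c″²)`, `c″ = pω/3`: every class `[C_u] ∈ Ш(E_F/F)` with `u·c(u)` a non-zero `c`-fixed cube VANISHES.
  Proof: all valuations of `u` are `≡ 0 (mod 3)` (P5a), `h(F) = 1` (`d_F = 24`) ⟹ `u = εz³`; at the inert `p`, `u` — hence `ε` —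
  is a local cube (P5b), so `ε` is a cube mod `(p)` (§2, `(p)` maximal §1), so `ε = η³` (§3, (h1)), `u = (ηz)³`, `[C_u] = 0`.

HONEST FRAMING: the `φ`-half box of a `3`-isogeny descent for ONE CM family under the decidable certificate (h1); the assembly over
`ℚ` (P7b: `Ш(E/ℚ) ∩ ker φ_* = 0`), `rank = 0 ∧ Ш[3] = 0` (P7c), `hDescU`, the crux (residual C⁺) and BSD are untouched. THEOREMS ONLY
(no `def`, no named fact, no sorry). Supports stmt-BirchSwinnertonDyer-21381.
[cite: CohenPazuki2009, Proposition 2.2 and §4] [cite: SilvermanAEC2009, Thm. X.4.2 (a), Prop. X.4.9]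
[cite: Marcus2018, Ch. 2 Thm. 1; Ch. 3 Thm. 25] [cite: Bhargava2004HCL1, Corollary 15]
-/

noncomputable section

open scoped Classical WithZero

namespace Summit.BirchSwinnertonDyer.BirchSwinnertonDyer.Theorems.SylvesterTwistDescent

open Literature.NumberTheory.EllipticCurves Literature.NumberTheory.EllipticCurves.MordellDescent
open Literature.NumberTheory.NumberFields IsDedekindDomain IsDedekindDomain.HeightOneSpectrum NumberField
open Literature.NumberTheory.Automorphic Literature.NumberTheory.QuadraticFields Literature.NumberTheory.QuadraticFields.Quadratic
open WithZero (log exp)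

variable {F : Type} [Field F] [NumberField F] (hF2 : Module.finrank ℚ F = 2) {ω : F} (hω : ω ^ 2 = 6)

/-! ## §1 The inert prime `(p)` of `ℚ(√6)` -/

include hF2 hω in
/-- **`d_F = 24`** for `[F:ℚ] = 2`, `ω² = 6` (`6 ≡ 2 (mod 4)` squarefree). [cite: Marcus2018, Ch. 2 Thm. 1] -/
theorem discr_eq_twentyFour : NumberField.discr F = 24 := by
  have hsf : Squarefree (6 : ℤ) := by
    rw [← Int.squarefree_natAbs, show Int.natAbs 6 = 2 * 3 by norm_num, Nat.squarefree_mul (by norm_num)]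
    exact ⟨Nat.prime_two.prime.squarefree, Nat.prime_three.prime.squarefree⟩
  have h := discr_eq_four_mul_of_sq_eq_intCast hF2 (θ := ω) (m := 6) (by rw [hω]; norm_num) (Or.inl (by norm_num)) hsf
  omega

include hF2 in
/-- The norm of a natural number `n ∈ 𝓞 F` is `n²` (`[F:ℚ] = 2`). [cite: Marcus2018, Ch. 2 (norm)] -/
theorem norm_natCast (n : ℕ) : Algebra.norm ℤ ((n : ℕ) : 𝓞 F) = (n : ℤ) ^ 2 := by
  rw [show ((n : ℕ) : 𝓞 F) = algebraMap ℤ (𝓞 F) (n : ℤ) by simp, Algebra.norm_algebraMap, RingOfIntegers.rank, hF2]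

include hF2 in
/-- **`n ∉ (p)` in `𝓞 F` for a prime `p ∤ n`** (taking norms: `p² ∣ n²`). [cite: Marcus2018, Ch. 3 Thm. 22 (norms of ideals)] -/
theorem natCast_not_mem_span_natCast {p n : ℕ} (hn : ¬ p ∣ n) :
    ((n : ℕ) : 𝓞 F) ∉ Ideal.span {((p : ℕ) : 𝓞 F)} := by
  intro h
  obtain ⟨x, hx⟩ := Ideal.mem_span_singleton'.mp h
  have hN := congrArg (Algebra.norm ℤ) hx
  rw [map_mul, norm_natCast hF2, norm_natCast hF2] at hN
  have hdvd : ((p : ℤ)) ^ 2 ∣ (n : ℤ) ^ 2 := ⟨Algebra.norm ℤ x, by rw [← hN]; ring⟩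
  rw [Int.pow_dvd_pow_iff two_ne_zero] at hdvd
  exact hn (by exact_mod_cast hdvd)

include hF2 hω in
/-- ★ **`(p)` is a MAXIMAL ideal of `𝓞 F` when `(6/p) = −1`** (`F = ℚ(ω)`, `ω² = 6`, i.e. `p` is INERT): in Bhargava's normal form
`𝓞 F = ℤ ⊕ ℤτ` with `τ² = ετ + m`, `d_F = ε + 4m = 24` forces `ε = 0`, `m = 6`; for `x = u + vτ ∉ (p)` the integer
`N = (u + vτ)(u − vτ) = u² − 6v²` is prime to `p` (else `6 ≡ (u/v)² (mod p)` or `p ∣ u, v`), and `k(u − vτ)` with `kN ≡ 1 (mod p)`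
inverts `x` modulo `(p)`. [cite: Marcus2018, Ch. 3 Thm. 25] -/
theorem span_natCast_isMaximal_of_not_isSquare_six {p : ℕ} (hp : p.Prime) (hsq : ¬ IsSquare (6 : ZMod p)) :
    (Ideal.span {((p : ℕ) : 𝓞 F)}).IsMaximal := by
  obtain ⟨T⟩ := nonempty_tauData (K := F) hF2
  have hd := discr_eq_twentyFour hF2 hω
  have hdisc := T.discr_eq
  have hεm : T.ε = 0 ∧ T.m = 6 := by rcases T.ε_eq with h | h <;> omega
  have hτ : T.τ * T.τ = 6 := by rw [T.τ_sq, hεm.1, hεm.2]; push_cast; ring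
  apply Ideal.Quotient.maximal_of_isField
  refine ⟨⟨0, 1, ?_⟩, mul_comm, ?_⟩
  · intro h01
    have h1 : (1 : 𝓞 F) ∈ Ideal.span {((p : ℕ) : 𝓞 F)} := by
      rw [← Ideal.Quotient.eq_zero_iff_mem, map_one]; exact h01.symm
    exact natCast_not_mem_span_natCast hF2 (p := p) (n := 1) (fun h => hp.one_lt.ne' (Nat.dvd_one.mp h)) (by simpa using h1)
  · intro q hq
    obtain ⟨x, rfl⟩ := Ideal.Quotient.mk_surjective q
    obtain ⟨u, v, hx⟩ := T.exists_int_coords x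
    have hx0 : x ∉ Ideal.span {((p : ℕ) : 𝓞 F)} := fun hmem => hq (Ideal.Quotient.eq_zero_iff_mem.mpr hmem)
    -- `p ∤ N = u² − 6v²`
    have hN : ¬ (p : ℤ) ∣ u ^ 2 - 6 * v ^ 2 := by
      haveI : Fact p.Prime := ⟨hp⟩
      intro hdvd
      have hz : (u : ZMod p) ^ 2 - 6 * (v : ZMod p) ^ 2 = 0 := by
        have := (ZMod.intCast_zmod_eq_zero_iff_dvd _ p).mpr hdvd
        push_cast at this
        exact this
      by_cases hv : (v : ZMod p) = 0
      · rw [hv] at hz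
        have hu : (u : ZMod p) = 0 := pow_eq_zero_iff two_ne_zero |>.mp (by simpa using hz)
        obtain ⟨u', hu'⟩ := (ZMod.intCast_zmod_eq_zero_iff_dvd u p).mp hu
        obtain ⟨v', hv'⟩ := (ZMod.intCast_zmod_eq_zero_iff_dvd v p).mp hv
        apply hx0
        rw [hx, hu', hv']
        refine Ideal.mem_span_singleton'.mpr ⟨(u' : 𝓞 F) + (v' : 𝓞 F) * T.τ, ?_⟩
        push_cast; ring
      · apply hsq
        refine ⟨(u : ZMod p) * (v : ZMod p)⁻¹, ?_⟩
        have hvv : (v : ZMod p) * (v : ZMod p)⁻¹ = 1 := mul_inv_cancel₀ hv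
        linear_combination (-((v : ZMod p)⁻¹ ^ 2)) * hz - (6 * ((v : ZMod p) * (v : ZMod p)⁻¹ + 1)) * hvv
    have hcop : IsCoprime (u ^ 2 - 6 * v ^ 2) (p : ℤ) := by
      rw [isCoprime_comm, Prime.coprime_iff_not_dvd (Nat.prime_iff_prime_int.mp hp)]
      exact hN
    obtain ⟨k, l, hkl⟩ := hcop
    refine ⟨Ideal.Quotient.mk _ ((k : 𝓞 F) * ((u : 𝓞 F) - (v : 𝓞 F) * T.τ)), ?_⟩
    rw [← map_mul, ← map_one (Ideal.Quotient.mk (Ideal.span {((p : ℕ) : 𝓞 F)})), Ideal.Quotient.eq]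
    have hklF : (k : 𝓞 F) * ((u : 𝓞 F) ^ 2 - 6 * (v : 𝓞 F) ^ 2) + (l : 𝓞 F) * ((p : ℕ) : 𝓞 F) = 1 := by
      have := congrArg (Int.cast : ℤ → 𝓞 F) hkl
      push_cast at this
      exact this
    have e : x * ((k : 𝓞 F) * ((u : 𝓞 F) - (v : 𝓞 F) * T.τ)) - 1 = (-(l : 𝓞 F)) * ((p : ℕ) : 𝓞 F) := by
      rw [hx]; linear_combination (-(k : 𝓞 F) * (v : 𝓞 F) ^ 2) * hτ + hklF
    rw [e]
    exact Ideal.mul_mem_left _ _ (Ideal.mem_span_singleton_self _)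

include hF2 hω in
/-- **`p` is a prime element of `𝓞 F`** for `(6/p) = −1`. [cite: Marcus2018, Ch. 3 Thm. 25] -/
theorem prime_natCast_of_not_isSquare_six {p : ℕ} (hp : p.Prime) (hsq : ¬ IsSquare (6 : ZMod p)) :
    Prime ((p : ℕ) : 𝓞 F) := by
  have hp0 : ((p : ℕ) : 𝓞 F) ≠ 0 := Nat.cast_ne_zero.mpr hp.ne_zero
  exact (Ideal.span_singleton_prime hp0).mp (span_natCast_isMaximal_of_not_isSquare_six hF2 hω hp hsq).isPrime

/-! ## §2 Residue approximation: a local cube is a cube modulo `v` -/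

/-- ★ **An algebraic integer which is a cube in `F_v` is a cube modulo `v`**: if `r = t³` in `F_v` then `t ∈ 𝒪_v`, `t ≡ a (mod 𝔪_v)`
for a global integer `a` (density), and `r − a³ = (t − a)(t² + ta + a²) ∈ 𝔪_v ∩ 𝓞 F = v`. [cite: CasselsFrohlichANT1967, Ch. II §7–§8] -/
theorem exists_sub_pow_three_mem_of_eq_cube {L : Type} [Field L] [NumberField L] (v : HeightOneSpectrum (𝓞 L)) {r : 𝓞 L}
    {t : v.adicCompletion L} (h : algebraMap L (v.adicCompletion L) (r : L) = t ^ 3) : ∃ a : 𝓞 L, r - a ^ 3 ∈ v.asIdeal := by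
  have hval : ∀ k : L, Valued.v (algebraMap L (v.adicCompletion L) k) = v.valuation L k :=
    fun k => valuedAdicCompletion_eq_valuation' v k
  have hint : ∀ s : 𝓞 L, Valued.v (algebraMap L (v.adicCompletion L) (s : L)) ≤ 1 := fun s => by
    rw [hval]; exact valuation_le_one v s
  have ht1 : Valued.v t ≤ 1 := by
    have h3 : Valued.v t ^ 3 ≤ 1 := by rw [← map_pow, ← h]; exact hint r
    exact (pow_le_one_iff three_ne_zero).mp h3
  obtain ⟨a, ha⟩ := exists_ringOfIntegers_valued_sub_lt_one L v ⟨t, ht1⟩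
  change Valued.v (algebraMap L (v.adicCompletion L) (a : L) - t) < 1 at ha
  refine ⟨a, ?_⟩
  have hq : Valued.v (algebraMap L (v.adicCompletion L) (a : L) ^ 2 + algebraMap L (v.adicCompletion L) (a : L) * t + t ^ 2) ≤ 1 := by
    refine le_trans (Valuation.map_add _ _ _) (max_le (le_trans (Valuation.map_add _ _ _) (max_le ?_ ?_)) ?_)
    · rw [map_pow]; exact pow_le_one₀ zero_le (hint a)
    · rw [map_mul]; exact mul_le_one' (hint a) ht1
    · rw [map_pow]; exact pow_le_one₀ zero_le ht1
  have hlt : Valued.v (algebraMap L (v.adicCompletion L) (((a ^ 3 - r : 𝓞 L) : L))) < 1 := by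
    have e1 : (((a ^ 3 - r : 𝓞 L)) : L) = (a : L) ^ 3 - (r : L) := by push_cast; ring
    have e : algebraMap L (v.adicCompletion L) (((a ^ 3 - r : 𝓞 L) : L)) =
        (algebraMap L (v.adicCompletion L) (a : L) - t) *
          (algebraMap L (v.adicCompletion L) (a : L) ^ 2 + algebraMap L (v.adicCompletion L) (a : L) * t + t ^ 2) := by
      rw [e1, map_sub, map_pow, h]; ring
    rw [e, map_mul]
    calc Valued.v (algebraMap L (v.adicCompletion L) (a : L) - t) *
          Valued.v (algebraMap L (v.adicCompletion L) (a : L) ^ 2 + algebraMap L (v.adicCompletion L) (a : L) * t + t ^ 2)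
        ≤ Valued.v (algebraMap L (v.adicCompletion L) (a : L) - t) * 1 := by gcongr
      _ < 1 := by rw [mul_one]; exact ha
  rw [hval] at hlt
  have hmem : a ^ 3 - r ∈ v.asIdeal := (valuation_lt_one_iff_mem v (a ^ 3 - r)).mp hlt
  have hneg := v.asIdeal.neg_mem hmem
  rwa [neg_sub] at hneg

/-! ## §3 Units of a real quadratic field modulo cubes -/

include hF2 in
/-- ★ **Units which are cubes modulo `I`.** In a REAL quadratic field (`U = 𝓞_Fˣ ≅ {±1} × ℤ`, `U/U³ ≅ ℤ/3` by `expMod3`): if some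
unit `u₀` is NOT a cube modulo the ideal `I`, then every unit `ε` which IS a cube modulo `I` is the cube of a unit (the subgroup of
units that are cubes mod `I` contains `U³`, is proper, and `U/U³` has prime order). [cite: Bhargava2004HCL1, Corollary 15] -/
theorem exists_eq_pow_three_of_sub_cube_mem (hd : 0 < NumberField.discr F) (I : Ideal (𝓞 F))
    (h1 : ∃ u₀ : (𝓞 F)ˣ, ∀ y : 𝓞 F, (u₀ : 𝓞 F) - y ^ 3 ∉ I) {ε : (𝓞 F)ˣ} (hε : ∃ x : 𝓞 F, (ε : 𝓞 F) - x ^ 3 ∈ I) :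
    ∃ η : (𝓞 F)ˣ, ε = η ^ 3 := by
  obtain ⟨u₀, hu₀⟩ := h1
  obtain ⟨x, hx⟩ := hε
  have hker := ker_expMod3 hF2 hd
  by_cases ha : expMod3 hF2 hd ε = 1
  · have hmem : ε ∈ unitCubes F := by rw [← hker, MonoidHom.mem_ker]; exact ha
    obtain ⟨η, hη⟩ := hmem
    exact ⟨η, by rw [← hη, powMonoidHom_apply]⟩
  · exfalso
    obtain ⟨n, hn⟩ : ∃ n : ℕ, expMod3 hF2 hd u₀ = expMod3 hF2 hd ε ^ n := by
      have key : ∀ s t : Multiplicative (ZMod 3), s ≠ 1 → (t = s ^ 0 ∨ t = s ^ 1 ∨ t = s ^ 2) := by decide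
      rcases key _ (expMod3 hF2 hd u₀) ha with h | h | h
      exacts [⟨0, h⟩, ⟨1, h⟩, ⟨2, h⟩]
    have hmem : u₀ * (ε ^ n)⁻¹ ∈ unitCubes F := by
      rw [← hker, MonoidHom.mem_ker, map_mul, map_inv, map_pow, hn, mul_inv_cancel]
    obtain ⟨η, hη⟩ := hmem
    rw [powMonoidHom_apply] at hη
    have hu₀eq : u₀ = ε ^ n * η ^ 3 := by rw [hη, ← mul_assoc, mul_comm (ε ^ n), mul_assoc, mul_inv_cancel, mul_one]
    have hval : (u₀ : 𝓞 F) = (ε : 𝓞 F) ^ n * (η : 𝓞 F) ^ 3 := by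
      rw [hu₀eq, Units.val_mul, Units.val_pow_eq_pow_val, Units.val_pow_eq_pow_val]
    apply hu₀ (x ^ n * (η : 𝓞 F))
    rw [← Ideal.Quotient.eq] at hx ⊢
    rw [hval, map_mul, map_pow, hx, ← map_pow, ← map_mul]
    congr 1; ring

/-! ## §4 The sharp `φ`-box -/

variable (c : F ≃ₐ[ℚ] F) {p : ℕ} (hp : p.Prime) (hp9 : p % 9 = 8) {a b : ℤ} (hab : a ^ 2 + 2 * b ^ 2 = p)

include hF2 hω hp hp9 hab in
/-- ★★ **THE SHARP `φ`-BOX.** For a quadratic number field `F ∋ ω`, `ω² = 6` (a model of `ℚ(√6)`), any `ℚ`-automorphism `c`, a prime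
`p ≡ 8 (mod 9)` with `p = a² + 2b²` (so `(6/p) = −1`), the CERTIFICATE (h1) «some unit `u₀ ∈ 𝓞_Fˣ` is not a cube modulo `(p)`», and
the `μ₃`-kernel Mordell datum `E_F = mordellCurve(−3c″²)`, `c″ = pω/3` (`E_F ≅ y² = x³ − 2p²`): every class `[C_u] ∈ Ш(E_F/F)` whose
parameter has CUBE NORM (`u · c u = r³`, `c r = r`, `r ≠ 0`) vanishes. [cite: CohenPazuki2009, Proposition 2.2 and §4]
[cite: SilvermanAEC2009, Thm. X.4.2 (a), Prop. X.4.9] -/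
theorem torsorClass_eq_zero_of_mem_sha_of_norm_cube_phi
    (h1 : ∃ u₀ : (𝓞 F)ˣ, ∀ x : 𝓞 F, (u₀ : 𝓞 F) - x ^ 3 ∉ Ideal.span {(p : 𝓞 F)})
    (hc' : (p * ω / 3 : F) ≠ 0) {D : F} (hD : D = -3 * (p * ω / 3) ^ 2) {u : F} (hu : u ≠ 0)
    (hnorm : ∃ r : F, c r = r ∧ r ≠ 0 ∧ u * c u = r ^ 3) (hsha : torsorClass hc' hD hu ∈ (mordellCurve D).sha) :
    torsorClass hc' hD hu = 0 := by
  -- ### all valuations of `u` are divisible by `3` (P5a) and `h(F) = 1`: `u = ε z³`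
  have hall : ∀ v : HeightOneSpectrum (𝓞 F), (3 : ℤ) ∣ log (v.valuation F u) :=
    three_dvd_log_valuation_phi hF2 hω c hc' hD hu hsha hnorm hp hp9 hab
  have hd24 := discr_eq_twentyFour hF2 hω
  haveI : IsPrincipalIdealRing (𝓞 F) :=
    (NumberField.classNumber_eq_one_iff (K := F)).mp (classNumber_eq_one_of_discr_eq_twentyFour hF2 hd24)
  obtain ⟨ε, z, huz⟩ := exists_unit_mul_cube_of_forall_dvd_valuation (K := F) hu hall
  have hz0 : z ≠ 0 := by
    rintro rfl
    rw [zero_pow three_ne_zero, mul_zero] at huz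
    exact hu huz
  -- ### the inert place `v₀ = (p)`
  have hsq6 : ¬ IsSquare (6 : ZMod p) := not_isSquare_six_zmod hp hp9 hab
  have hπ : Prime ((p : ℕ) : 𝓞 F) := prime_natCast_of_not_isSquare_six hF2 hω hp hsq6
  obtain ⟨v₀, hv₀⟩ := exists_place_of_prime (K := F) hπ
  have hp5 : 5 ≤ p := by have := hp.two_le; omega
  have h2 : ((2 : ℕ) : 𝓞 F) ∉ v₀.asIdeal := by
    rw [hv₀]; exact natCast_not_mem_span_natCast hF2 (fun h => by have := Nat.le_of_dvd two_pos h; omega)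
  have h3 : ((3 : ℕ) : 𝓞 F) ∉ v₀.asIdeal := by
    rw [hv₀]; exact natCast_not_mem_span_natCast hF2 (fun h => by have := Nat.le_of_dvd three_pos h; omega)
  have hvp : v₀.valuation F (p : F) = exp (-1 : ℤ) := by
    rw [← coe_natCast_ringOfIntegers (K := F) p]; exact valuation_self_of_span hπ hv₀
  -- ### `u`, hence `ε`, is a cube in `F_{v₀}` (P5b)
  obtain ⟨z₁, hz₁0, hz₁⟩ := exists_eq_cube_adicCompletion_of_inert hω hc' hD hu hsha v₀ h2 h3 hvp (hall v₀)
  have hιz : algebraMap F (v₀.adicCompletion F) z ≠ 0 := (map_ne_zero _).mpr hz0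
  have hεcube : algebraMap F (v₀.adicCompletion F) ((ε : 𝓞 F) : F) = (z₁ / algebraMap F (v₀.adicCompletion F) z) ^ 3 := by
    rw [div_pow, ← hz₁, huz, map_mul, map_pow, mul_div_cancel_right₀ _ (pow_ne_zero 3 hιz)]
  -- ### so `ε` is a cube modulo `(p)`, hence the cube of a unit by (h1)
  obtain ⟨a₀, ha₀⟩ := exists_sub_pow_three_mem_of_eq_cube v₀ hεcube
  rw [hv₀] at ha₀
  obtain ⟨η, hη⟩ := exists_eq_pow_three_of_sub_cube_mem hF2 (by rw [hd24]; norm_num) _ h1 ⟨a₀, ha₀⟩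
  -- ### `u = (η z)³`
  refine MordellDescent.torsorClass_of_eq_cube hc' hD hu (algebraMap (𝓞 F) F (η : 𝓞 F) * z) ?_
  rw [huz, hη, mul_pow, Units.val_pow_eq_pow_val, map_pow]

end Summit.BirchSwinnertonDyer.BirchSwinnertonDyer.Theorems.SylvesterTwistDescent

end
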